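import Literature.Geometry.Lorentzian.KerrDeSitterThresholdRays
import Literature.Geometry.Lorentzian.KerrDeSitterRadialEnergyIdentity
import HarnessLib

/-!
# The horizon function of subextremal Kerr–de Sitter: the printed factorisation
# `Δ = −L⁻²(r − r₀)(r − r₁)(r − r₂)(r − r₃)`, `r₃ = −r₀ − r₁ − r₂`, and the surface gravities
# `κ_j = |∏_{j'≠j}(r_j − r_{j'})|/(2L²Ξ(r_j² + a²))` — with `κ_j > 0` and `κ₁ < κ₀` (theorems only)

Theorems only (no named facts, no new definitions). Source read verbatim: M. Casals,
R. Teixeira da Costa, *Hidden spectral symmetries and mode stability of subextremal Kerr(-de Sitter)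
black holes* [CasalsTeixeiradacosta2022], arXiv:2105.13329 v3, §3.1: "Fix `M > 0`, `Λ > 0` and
`|a| < 3/Λ` satisfying (3.1) … Then … `Δ := (r²+a²)(1 − r²/L²) − 2Mr = −(1/L²)(r−r₂)(r−r₁)(r−r₀)(r−r₃)`
has four distinct real roots, denoted `0 < r₀ < r₁ < r₂` and `r₃ = −r₂ − r₁ − r₀ < 0`" ((3.2),
`L² = 3/Λ`), and (3.10): "`κ_j := (1/(2L²Ξ(r_j²+a²))) |∏_{j'≠j}(r_j − r_{j'})|` … the surface gravity
of the horizon at `r = r_j`".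

The tree's `IsSubextremal M a Λ` (`KerrDeSitter.lean`) records the SIGN PATTERN of `Δ_r` at the
three radii `rMinus < rPlus < rCosmo` (defined by `sInf`/`sSup` of sign sets) together with
`Δ_r(r₊) = Δ_r(r_c) = 0`; it does not literally contain `Δ_r(r₋) = 0` nor the factorisation. This
file derives them, and with them the closed forms of the three surface gravities
`surfaceGravity M a Λ r_j = |Δ_r'(r_j)|/(2Ξ(r_j²+a²))` (`KerrDeSitterThresholdRays.lean`):

* `delta_rMinus` — `Δ_r(r₋) = 0` (from the infimum and continuity; for `a = 0`, `r₋ = 0` and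
  `Δ_r(0) = a² = 0`); `rMinus_pos` — `r₋ > 0` iff `a ≠ 0` (as `Δ_r(0) = a²`);
* `delta_eq_prod` — ★ `Δ_r(r) = −(Λ/3)(r − r₋)(r − r₊)(r − r_c)(r + r₋ + r₊ + r_c)` for all `r`
  (three distinct roots of a quartic with no cubic term; the quadratic remainder vanishes at three
  points), i.e. the printed (3.2) with `r₃ = rNeg M a Λ = −(r₋ + r₊ + r_c)`; the Vieta relations
  `vieta_sq`, `vieta_M`, `vieta_aSq` (`1 − Λa²/3`, `2M`, `a²` through the roots);
* `deltaDeriv_rMinus_eq`, `deltaDeriv_rPlus_eq`, `deltaDeriv_rCosmo_eq` — `Δ_r'(r_j) = −(Λ/3)∏_{j'≠j}(r_j − r_{j'})`,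
  hence the printed (3.10) product forms `surfaceGravity_rMinus_eq`, `…_rPlus_eq`, `…_rCosmo_eq`
  and `deltaDeriv_rMinus_neg` (`Δ_r'(r₋) < 0` for `a ≠ 0`);
* `surfaceGravity_rPlus_pos`, `surfaceGravity_rCosmo_pos` (always), `surfaceGravity_rMinus_pos`
  (`a ≠ 0`; at `a = 0` the tree's `κ₀` is the junk value `|−2M|/0 = 0`);
* ★ `surfaceGravity_rPlus_lt_rMinus` — `κ₁ < κ₀` for every subextremal Kerr–de Sitter black hole with
  `a ≠ 0`: the Cauchy horizon is "hotter" than the event horizon. This is the side condition under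
  which `pairCondition_eventCauchy` (`KerrDeSitterThresholdRays.lean`) discharges Proposition 3.8's
  hypothesis for the pair `m₁ + m₃` — the printed proof of Corollary 3.9 asserts that "the conditions
  of Proposition 3.8 clearly hold under our assumptions", which for all `Im ω ≥ 0` requires exactly
  `1/κ₀ ≤ 1/κ₁`; here it is PROVED (resolving that file's `TODO … κ₁ ≤ κ₀ from IsSubextremal`):
  with roots `0 < x < y < z`, `(z−y)(x+2y+z)(x²+a²) < (z−x)(2x+y+z)(y²+a²)` because the difference
  is `(y−x)(x+y)(z² + z(x+y) − xy + 2a²) > 0`;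
* `sq_lt_three_div_of_isSubextremal` (`a² < 3/Λ`, i.e. the printed `|a| < L` follows from (3.1)),
  `xi_lt_two_of_isSubextremal`, `abs_lt_deSitterRadius_of_isSubextremal` (appended);
* `surfaceGravity_pos_and_le` — the conjunction `0 < κ₀ ∧ 0 < κ₁ ∧ 0 < κ₂ ∧ κ₁ ≤ κ₀` in the shape
  the venture's window-constants hypothesis (H4) lists it (`Summits/Ventures/KdS/ModeStability.lean`),
  now a consequence of `IsSubextremal ∧ a ≠ 0` alone.

## References
* M. Casals, R. Teixeira da Costa, Commun. Math. Phys. 394 (2022) 797–832, arXiv:2105.13329 v3,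
  §3.1 (3.1)–(3.2), (3.10), proof of Corollary 3.9. [CasalsTeixeiradacosta2022]
* O. Petersen, A. Vasy, arXiv:2112.01355, (1.2)–(1.3) (the horizon function and its roots; the tree's
  `IsSubextremal`). [PetersenVasy2021]
-/

noncomputable section

open Set Filter Topology

namespace Literature.Geometry.Lorentzian.KerrDeSitter

/-! ### `Δ_r(r₋) = 0` and `r₋ > 0` -/

/-- `Δ_r` is continuous (a polynomial; private twin of the venture's `continuous_delta`, which a
Literature file cannot import). [cite: PetersenVasy2021, (1.2)] -/
private theorem delta_continuous (M a Λ : ℝ) : Continuous fun r => delta M a Λ r := by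
  unfold delta
  fun_prop

/-- `Δ_r(0) = a²`. [cite: PetersenVasy2021, (1.2)] -/
theorem delta_at_zero (M a Λ : ℝ) : delta M a Λ 0 = a ^ 2 := by
  simp [delta]

/-- **The Cauchy horizon is a root**: `Δ_r(r₋) = 0` for subextremal parameters. (`r₋` is the infimum
of `{r > 0 : Δ_r(r) ≤ 0}`; `Δ_r < 0` just above `r₋` forbids `Δ_r(r₋) > 0`, and `Δ_r(r₋) < 0` would put
smaller positive radii in that set — unless `r₋ = 0`, where `Δ_r(0) = a² ≥ 0`.) Printed as
"`Δ` has four distinct real roots, denoted `0 < r₀ < r₁ < r₂` and `r₃`". [cite: CasalsTeixeiradacosta2022, (3.2)] -/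
theorem delta_rMinus {M a Λ : ℝ} (hsub : IsSubextremal M a Λ) : delta M a Λ (rMinus M a Λ) = 0 := by
  obtain ⟨hM, hΛ, h01, h12, -, -, hneg, -, -⟩ := hsub
  have hc : ContinuousAt (fun r => delta M a Λ r) (rMinus M a Λ) :=
    (delta_continuous M a Λ).continuousAt
  have h0 := rMinus_nonneg M a Λ
  apply le_antisymm
  · -- `Δ_r(r₋) ≤ 0`: otherwise `Δ_r > 0` just above `r₋`, inside `(r₋, r₊)` where `Δ_r < 0`
    by_contra hcon
    rw [not_le] at hcon
    have hev : ∀ᶠ r in 𝓝 (rMinus M a Λ), 0 < delta M a Λ r := hc.eventually (eventually_gt_nhds hcon)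
    obtain ⟨r, hr, hrI⟩ := ((hev.filter_mono nhdsWithin_le_nhds).and (Ioo_mem_nhdsGT h01)).exists
    exact absurd (hneg r hrI) (not_lt.2 hr.le)
  · -- `Δ_r(r₋) ≥ 0`: otherwise a smaller positive radius has `Δ_r ≤ 0`
    by_contra hcon
    rw [not_le] at hcon
    rcases h0.eq_or_lt with hz | hpos
    · rw [← hz, delta_at_zero] at hcon
      exact absurd hcon (not_lt.2 (sq_nonneg a))
    · have hev : ∀ᶠ r in 𝓝 (rMinus M a Λ), delta M a Λ r < 0 :=
        hc.eventually (eventually_lt_nhds hcon)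
      obtain ⟨r, hr, hrI⟩ :=
        ((hev.filter_mono nhdsWithin_le_nhds).and (Ioo_mem_nhdsLT hpos)).exists
      have hmem : r ∈ {r | 0 < r ∧ delta M a Λ r ≤ 0} := ⟨hrI.1, hr.le⟩
      have hle : rMinus M a Λ ≤ r := by
        unfold rMinus
        exact csInf_le ⟨0, fun x hx => hx.1.le⟩ hmem
      exact absurd hrI.2 (not_lt.2 hle)

/-- For `a ≠ 0` the Cauchy horizon radius is positive (`Δ_r(0) = a² ≠ 0 = Δ_r(r₋)`); conversely for
`a = 0` it is `0`. Printed: "`0 < r₀`". [cite: CasalsTeixeiradacosta2022, (3.2)] -/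
theorem rMinus_pos {M a Λ : ℝ} (hsub : IsSubextremal M a Λ) (ha : a ≠ 0) : 0 < rMinus M a Λ := by
  rcases (rMinus_nonneg M a Λ).eq_or_lt with hz | hpos
  · have h := delta_rMinus hsub
    rw [← hz, delta_at_zero] at h
    exact absurd h (pow_ne_zero 2 ha)
  · exact hpos

/-! ### The factorisation (3.2) and the Vieta relations -/

/-- **Casals–Teixeira da Costa (3.2): `Δ = −L⁻²(r − r₂)(r − r₁)(r − r₀)(r − r₃)` with
`r₃ = −r₂ − r₁ − r₀`**, for the tree's radii: on subextremal Kerr–de Sitter, for every real `r`,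
`Δ_r(r) = −(Λ/3)(r − r₋)(r − r₊)(r − r_c)(r + r₋ + r₊ + r_c)`. Proof: the difference of the two sides is
a polynomial of degree `≤ 2` (the quartic has no cubic term) vanishing at the three distinct roots
`r₋ < r₊ < r_c`. [cite: CasalsTeixeiradacosta2022, (3.2)] -/
theorem delta_eq_prod {M a Λ : ℝ} (hsub : IsSubextremal M a Λ) (r : ℝ) :
    delta M a Λ r = -(Λ / 3) * (r - rMinus M a Λ) * (r - rPlus M a Λ) * (r - rCosmo M a Λ) *
      (r + rMinus M a Λ + rPlus M a Λ + rCosmo M a Λ) := by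
  have hΔ0 := delta_rMinus hsub
  obtain ⟨hM, hΛ, h01, h12, hΔ1, hΔ2, -, -, -⟩ := hsub
  set x := rMinus M a Λ
  set y := rPlus M a Λ
  set z := rCosmo M a Λ
  -- the quadratic remainder `Q(r) = c₂ r² + c₁ r + c₀`
  set s := x + y + z with hs
  set e₂ := x * y + y * z + z * x with he₂
  set e₃ := x * y * z with he₃
  set c₂ := 1 - Λ / 3 * a ^ 2 + Λ / 3 * (e₂ - s ^ 2) with hc₂
  set c₁ := -2 * M + Λ / 3 * (e₂ * s - e₃) with hc₁
  set c₀ := a ^ 2 - Λ / 3 * (e₃ * s) with hc₀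
  have hQ : ∀ t, delta M a Λ t + Λ / 3 * (t - x) * (t - y) * (t - z) * (t + x + y + z) =
      c₂ * t ^ 2 + c₁ * t + c₀ := by
    intro t
    simp only [delta, hc₂, hc₁, hc₀, hs, he₂, he₃]
    ring
  have hQx : c₂ * x ^ 2 + c₁ * x + c₀ = 0 := by rw [← hQ x, hΔ0]; ring
  have hQy : c₂ * y ^ 2 + c₁ * y + c₀ = 0 := by rw [← hQ y, hΔ1]; ring
  have hQz : c₂ * z ^ 2 + c₁ * z + c₀ = 0 := by rw [← hQ z, hΔ2]; ring
  have hxy : x - y ≠ 0 := by simp only [x, y]; linarith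
  have hyz : y - z ≠ 0 := by simp only [y, z]; linarith
  have hxz : x - z ≠ 0 := by simp only [x, z]; linarith
  have h1 : c₂ * (x + y) + c₁ = 0 := by
    have : (x - y) * (c₂ * (x + y) + c₁) = 0 := by linear_combination hQx - hQy
    exact (mul_eq_zero.1 this).resolve_left hxy
  have h2 : c₂ * (y + z) + c₁ = 0 := by
    have : (y - z) * (c₂ * (y + z) + c₁) = 0 := by linear_combination hQy - hQz
    exact (mul_eq_zero.1 this).resolve_left hyz
  have hc₂0 : c₂ = 0 := by
    have : (x - z) * c₂ = 0 := by linear_combination h1 - h2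
    exact (mul_eq_zero.1 this).resolve_left hxz
  have hc₁0 : c₁ = 0 := by rw [hc₂0] at h1; linarith
  have hc₀0 : c₀ = 0 := by rw [hc₂0, hc₁0] at hQx; linarith
  have key := hQ r
  rw [hc₂0, hc₁0, hc₀0] at key
  linear_combination key

/-- Vieta for the `r²`-coefficient: `1 − Λa²/3 = (Λ/3)(s² − e₂)` with `s = r₋ + r₊ + r_c`,
`e₂ = r₋r₊ + r₊r_c + r_cr₋` (compare (3.2)). [cite: CasalsTeixeiradacosta2022, (3.2)] -/
theorem vieta_sq {M a Λ : ℝ} (hsub : IsSubextremal M a Λ) :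
    1 - Λ / 3 * a ^ 2 = Λ / 3 * ((rMinus M a Λ + rPlus M a Λ + rCosmo M a Λ) ^ 2 -
      (rMinus M a Λ * rPlus M a Λ + rPlus M a Λ * rCosmo M a Λ + rCosmo M a Λ * rMinus M a Λ)) := by
  have h0 := delta_eq_prod hsub 0
  have h1 := delta_eq_prod hsub 1
  have h2 := delta_eq_prod hsub (-1)
  simp only [delta] at h0 h1 h2
  linear_combination (1 / 2 : ℝ) * h1 + (1 / 2 : ℝ) * h2 - h0

/-- Vieta for the `r`-coefficient: `2M = (Λ/3)(e₂ s − e₃)`, `e₃ = r₋r₊r_c`. [cite: CasalsTeixeiradacosta2022, (3.2)] -/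
theorem vieta_M {M a Λ : ℝ} (hsub : IsSubextremal M a Λ) :
    2 * M = Λ / 3 * ((rMinus M a Λ * rPlus M a Λ + rPlus M a Λ * rCosmo M a Λ +
      rCosmo M a Λ * rMinus M a Λ) * (rMinus M a Λ + rPlus M a Λ + rCosmo M a Λ) -
        rMinus M a Λ * rPlus M a Λ * rCosmo M a Λ) := by
  have h1 := delta_eq_prod hsub 1
  have h2 := delta_eq_prod hsub (-1)
  simp only [delta] at h1 h2
  linear_combination (-1 / 2 : ℝ) * h1 + (1 / 2 : ℝ) * h2

/-- Vieta for the constant coefficient: `a² = (Λ/3) r₋ r₊ r_c (r₋ + r₊ + r_c)` (`= −L⁻² r₀r₁r₂r₃`).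
[cite: CasalsTeixeiradacosta2022, (3.2)] -/
theorem vieta_aSq {M a Λ : ℝ} (hsub : IsSubextremal M a Λ) :
    a ^ 2 = Λ / 3 * (rMinus M a Λ * rPlus M a Λ * rCosmo M a Λ) *
      (rMinus M a Λ + rPlus M a Λ + rCosmo M a Λ) := by
  have h0 := delta_eq_prod hsub 0
  simp only [delta] at h0
  linear_combination h0

/-! ### `Δ_r'` at the horizons and the printed product form (3.10) of the surface gravities -/

/-- `Δ_r'(r₋) = −(Λ/3)(r₋ − r₊)(r₋ − r_c)(2r₋ + r₊ + r_c)`. [cite: CasalsTeixeiradacosta2022, (3.10)] -/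
theorem deltaDeriv_rMinus_eq {M a Λ : ℝ} (hsub : IsSubextremal M a Λ) :
    deltaDeriv M a Λ (rMinus M a Λ) = -(Λ / 3) * (rMinus M a Λ - rPlus M a Λ) *
      (rMinus M a Λ - rCosmo M a Λ) * (2 * rMinus M a Λ + rPlus M a Λ + rCosmo M a Λ) := by
  have h1 := vieta_sq hsub
  have h2 := vieta_M hsub
  simp only [deltaDeriv]
  linear_combination (2 * rMinus M a Λ) * h1 - h2

/-- `Δ_r'(r₊) = −(Λ/3)(r₊ − r₋)(r₊ − r_c)(r₋ + 2r₊ + r_c)`. [cite: CasalsTeixeiradacosta2022, (3.10)] -/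
theorem deltaDeriv_rPlus_eq {M a Λ : ℝ} (hsub : IsSubextremal M a Λ) :
    deltaDeriv M a Λ (rPlus M a Λ) = -(Λ / 3) * (rPlus M a Λ - rMinus M a Λ) *
      (rPlus M a Λ - rCosmo M a Λ) * (rMinus M a Λ + 2 * rPlus M a Λ + rCosmo M a Λ) := by
  have h1 := vieta_sq hsub
  have h2 := vieta_M hsub
  simp only [deltaDeriv]
  linear_combination (2 * rPlus M a Λ) * h1 - h2

/-- `Δ_r'(r_c) = −(Λ/3)(r_c − r₋)(r_c − r₊)(r₋ + r₊ + 2r_c)`. [cite: CasalsTeixeiradacosta2022, (3.10)] -/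
theorem deltaDeriv_rCosmo_eq {M a Λ : ℝ} (hsub : IsSubextremal M a Λ) :
    deltaDeriv M a Λ (rCosmo M a Λ) = -(Λ / 3) * (rCosmo M a Λ - rMinus M a Λ) *
      (rCosmo M a Λ - rPlus M a Λ) * (rMinus M a Λ + rPlus M a Λ + 2 * rCosmo M a Λ) := by
  have h1 := vieta_sq hsub
  have h2 := vieta_M hsub
  simp only [deltaDeriv]
  linear_combination (2 * rCosmo M a Λ) * h1 - h2

/-- For `a ≠ 0`, `Δ_r` crosses DOWNWARD at the Cauchy horizon: `Δ_r'(r₋) < 0`.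
[cite: CasalsTeixeiradacosta2022, (3.2)] -/
theorem deltaDeriv_rMinus_neg {M a Λ : ℝ} (hsub : IsSubextremal M a Λ) (ha : a ≠ 0) :
    deltaDeriv M a Λ (rMinus M a Λ) < 0 := by
  have hx := rMinus_pos hsub ha
  rw [deltaDeriv_rMinus_eq hsub]
  obtain ⟨hM, hΛ, h01, h12, -⟩ := hsub
  have e : -(Λ / 3) * (rMinus M a Λ - rPlus M a Λ) * (rMinus M a Λ - rCosmo M a Λ) *
      (2 * rMinus M a Λ + rPlus M a Λ + rCosmo M a Λ) =
      -(Λ / 3 * (rPlus M a Λ - rMinus M a Λ) * (rCosmo M a Λ - rMinus M a Λ) *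
        (2 * rMinus M a Λ + rPlus M a Λ + rCosmo M a Λ)) := by ring
  rw [e, neg_lt_zero]
  have hΛ3 : 0 < Λ / 3 := by positivity
  exact mul_pos (mul_pos (mul_pos hΛ3 (by linarith)) (by linarith)) (by linarith)

/-- **(3.10) for `κ₀`**: `κ₀ = (Λ/3)(r₊ − r₋)(r_c − r₋)(2r₋ + r₊ + r_c)/(2Ξ(r₋² + a²))`
(`|r₀ − r₃| = 2r₀ + r₁ + r₂`). [cite: CasalsTeixeiradacosta2022, (3.10)] -/
theorem surfaceGravity_rMinus_eq {M a Λ : ℝ} (hsub : IsSubextremal M a Λ) :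
    surfaceGravity M a Λ (rMinus M a Λ) =
      Λ / 3 * (rPlus M a Λ - rMinus M a Λ) * (rCosmo M a Λ - rMinus M a Λ) *
        (2 * rMinus M a Λ + rPlus M a Λ + rCosmo M a Λ) / (2 * xi a Λ * (rMinus M a Λ ^ 2 + a ^ 2)) := by
  have h0 := rMinus_nonneg M a Λ
  unfold surfaceGravity
  rw [deltaDeriv_rMinus_eq hsub]
  obtain ⟨hM, hΛ, h01, h12, -⟩ := hsub
  congr 1
  rw [abs_of_nonpos]
  · ring
  · have hΛ3 : 0 < Λ / 3 := by positivity
    have : 0 ≤ Λ / 3 * (rPlus M a Λ - rMinus M a Λ) * (rCosmo M a Λ - rMinus M a Λ) *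
        (2 * rMinus M a Λ + rPlus M a Λ + rCosmo M a Λ) :=
      mul_nonneg (mul_nonneg (mul_nonneg hΛ3.le (by linarith)) (by linarith)) (by linarith)
    linarith

/-- **(3.10) for `κ₁`**: `κ₁ = (Λ/3)(r₊ − r₋)(r_c − r₊)(r₋ + 2r₊ + r_c)/(2Ξ(r₊² + a²))`.
[cite: CasalsTeixeiradacosta2022, (3.10)] -/
theorem surfaceGravity_rPlus_eq {M a Λ : ℝ} (hsub : IsSubextremal M a Λ) :
    surfaceGravity M a Λ (rPlus M a Λ) =
      Λ / 3 * (rPlus M a Λ - rMinus M a Λ) * (rCosmo M a Λ - rPlus M a Λ) *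
        (rMinus M a Λ + 2 * rPlus M a Λ + rCosmo M a Λ) / (2 * xi a Λ * (rPlus M a Λ ^ 2 + a ^ 2)) := by
  have h0 := rMinus_nonneg M a Λ
  unfold surfaceGravity
  rw [deltaDeriv_rPlus_eq hsub]
  obtain ⟨hM, hΛ, h01, h12, -⟩ := hsub
  congr 1
  rw [abs_of_nonneg]
  · ring
  · have hΛ3 : 0 < Λ / 3 := by positivity
    have : 0 ≤ Λ / 3 * (rPlus M a Λ - rMinus M a Λ) * (rCosmo M a Λ - rPlus M a Λ) *
        (rMinus M a Λ + 2 * rPlus M a Λ + rCosmo M a Λ) :=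
      mul_nonneg (mul_nonneg (mul_nonneg hΛ3.le (by linarith)) (by linarith)) (by linarith)
    linarith

/-- **(3.10) for `κ₂`**: `κ₂ = (Λ/3)(r_c − r₋)(r_c − r₊)(r₋ + r₊ + 2r_c)/(2Ξ(r_c² + a²))`.
[cite: CasalsTeixeiradacosta2022, (3.10)] -/
theorem surfaceGravity_rCosmo_eq {M a Λ : ℝ} (hsub : IsSubextremal M a Λ) :
    surfaceGravity M a Λ (rCosmo M a Λ) =
      Λ / 3 * (rCosmo M a Λ - rMinus M a Λ) * (rCosmo M a Λ - rPlus M a Λ) *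
        (rMinus M a Λ + rPlus M a Λ + 2 * rCosmo M a Λ) / (2 * xi a Λ * (rCosmo M a Λ ^ 2 + a ^ 2)) := by
  have h0 := rMinus_nonneg M a Λ
  unfold surfaceGravity
  rw [deltaDeriv_rCosmo_eq hsub]
  obtain ⟨hM, hΛ, h01, h12, -⟩ := hsub
  congr 1
  rw [abs_of_nonpos]
  · ring
  · have hΛ3 : 0 < Λ / 3 := by positivity
    have : 0 ≤ Λ / 3 * (rCosmo M a Λ - rMinus M a Λ) * (rCosmo M a Λ - rPlus M a Λ) *
        (rMinus M a Λ + rPlus M a Λ + 2 * rCosmo M a Λ) :=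
      mul_nonneg (mul_nonneg (mul_nonneg hΛ3.le (by linarith)) (by linarith)) (by linarith)
    linarith

/-! ### Positivity and the ordering `κ₁ < κ₀` -/

/-- `κ₁ > 0` on subextremal Kerr–de Sitter. [cite: CasalsTeixeiradacosta2022, (3.10)] -/
theorem surfaceGravity_rPlus_pos {M a Λ : ℝ} (hsub : IsSubextremal M a Λ) :
    0 < surfaceGravity M a Λ (rPlus M a Λ) := by
  have hd := deltaDeriv_rPlus_pos hsub
  obtain ⟨hM, hΛ, h01, h12, -⟩ := hsub
  have hr₁ : 0 < rPlus M a Λ := lt_of_le_of_lt (rMinus_nonneg M a Λ) h01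
  unfold surfaceGravity
  have hξ := xi_pos hΛ.le a
  exact div_pos (abs_pos.2 hd.ne') (by positivity)

/-- `κ₂ > 0` on subextremal Kerr–de Sitter. [cite: CasalsTeixeiradacosta2022, (3.10)] -/
theorem surfaceGravity_rCosmo_pos {M a Λ : ℝ} (hsub : IsSubextremal M a Λ) :
    0 < surfaceGravity M a Λ (rCosmo M a Λ) := by
  have hd := deltaDeriv_rCosmo_neg hsub
  obtain ⟨hM, hΛ, h01, h12, -⟩ := hsub
  unfold surfaceGravity
  have hξ := xi_pos hΛ.le a
  have hr₂ : 0 < rCosmo M a Λ := (lt_of_le_of_lt (rMinus_nonneg M a Λ) h01).trans h12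
  exact div_pos (abs_pos.2 hd.ne) (by positivity)

/-- `κ₀ > 0` on subextremal Kerr–de Sitter with `a ≠ 0` (at `a = 0`, `r₋ = 0` and the tree's `κ₀` is
the junk value `0`). [cite: CasalsTeixeiradacosta2022, (3.10)] -/
theorem surfaceGravity_rMinus_pos {M a Λ : ℝ} (hsub : IsSubextremal M a Λ) (ha : a ≠ 0) :
    0 < surfaceGravity M a Λ (rMinus M a Λ) := by
  have hd := deltaDeriv_rMinus_neg hsub ha
  obtain ⟨hM, hΛ, -⟩ := hsub
  unfold surfaceGravity
  have hξ := xi_pos hΛ.le a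
  have ha2 : 0 < a ^ 2 := by positivity
  exact div_pos (abs_pos.2 hd.ne) (by positivity)

/-- **`κ₁ < κ₀`: on every subextremal Kerr–de Sitter black hole with `a ≠ 0` the surface gravity of the
event horizon is smaller than that of the Cauchy horizon.** With the roots `0 < x = r₋ < y = r₊ < z = r_c`
and (3.10), `κ₁ < κ₀ ⟺ (z−y)(x+2y+z)(x²+a²) < (z−x)(2x+y+z)(y²+a²)`, and the difference of the two
sides is `(y−x)(x+y)(z² + z(x+y) − xy + 2a²) > 0`. This is the (unstated) inequality behind the printed
"the conditions of Proposition 3.8 clearly hold under our assumptions" in the proof of Corollary 3.9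
(the pair `m₁ + m₃ = −2(η₁+η₀)` has `Re = Im ω(1/κ₀ − 1/κ₁)`, `< 1` for all `Im ω ≥ 0` iff `κ₁ ≤ κ₀`;
`pairCondition_eventCauchy`). [cite: CasalsTeixeiradacosta2022, (3.10) and proof of Corollary 3.9] -/
theorem surfaceGravity_rPlus_lt_rMinus {M a Λ : ℝ} (hsub : IsSubextremal M a Λ) (ha : a ≠ 0) :
    surfaceGravity M a Λ (rPlus M a Λ) < surfaceGravity M a Λ (rMinus M a Λ) := by
  have hx := rMinus_pos hsub ha
  rw [surfaceGravity_rPlus_eq hsub, surfaceGravity_rMinus_eq hsub]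
  obtain ⟨hM, hΛ, h01, h12, -⟩ := hsub
  set x := rMinus M a Λ
  set y := rPlus M a Λ
  set z := rCosmo M a Λ
  have hξ := xi_pos hΛ.le a
  have ha2 : 0 < a ^ 2 := by positivity
  have hΛ3 : 0 < Λ / 3 := by positivity
  have hDx : 0 < 2 * xi a Λ * (x ^ 2 + a ^ 2) := by positivity
  have hDy : 0 < 2 * xi a Λ * (y ^ 2 + a ^ 2) := by positivity
  rw [div_lt_div_iff₀ hDy hDx]
  -- reduce to the polynomial inequality
  have hyx : 0 < y - x := by linarith
  have key : 0 < (y - x) * (x + y) * (z ^ 2 + z * (x + y) - x * y + 2 * a ^ 2) := by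
    have h1 : 0 < z ^ 2 + z * (x + y) - x * y + 2 * a ^ 2 := by nlinarith
    have h2 : 0 < x + y := by linarith
    positivity
  -- LHS: κ₁-numerator · κ₀-denominator; RHS: κ₀-numerator · κ₁-denominator
  have hid : Λ / 3 * (y - x) * (z - x) * (2 * x + y + z) * (2 * xi a Λ * (y ^ 2 + a ^ 2)) -
      Λ / 3 * (y - x) * (z - y) * (x + 2 * y + z) * (2 * xi a Λ * (x ^ 2 + a ^ 2)) =
      Λ / 3 * (2 * xi a Λ) * (y - x) * ((y - x) * (x + y) * (z ^ 2 + z * (x + y) - x * y + 2 * a ^ 2)) := by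
    ring
  have hpos : 0 < Λ / 3 * (2 * xi a Λ) * (y - x) *
      ((y - x) * (x + y) * (z ^ 2 + z * (x + y) - x * y + 2 * a ^ 2)) := by positivity
  nlinarith [hid, hpos]

/-- The four surface-gravity side conditions of the venture's window-constants hypothesis (H4) —
`0 < κ₀`, `0 < κ₁`, `0 < κ₂`, `κ₁ ≤ κ₀` — hold on EVERY subextremal Kerr–de Sitter black hole with
`a ≠ 0` (no enclosure needed). [cite: CasalsTeixeiradacosta2022, (3.10) and proof of Corollary 3.9] -/
theorem surfaceGravity_pos_and_le {M a Λ : ℝ} (hsub : IsSubextremal M a Λ) (ha : a ≠ 0) :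
    0 < surfaceGravity M a Λ (rMinus M a Λ) ∧ 0 < surfaceGravity M a Λ (rPlus M a Λ) ∧
      0 < surfaceGravity M a Λ (rCosmo M a Λ) ∧
      surfaceGravity M a Λ (rPlus M a Λ) ≤ surfaceGravity M a Λ (rMinus M a Λ) :=
  ⟨surfaceGravity_rMinus_pos hsub ha, surfaceGravity_rPlus_pos hsub, surfaceGravity_rCosmo_pos hsub,
    (surfaceGravity_rPlus_lt_rMinus hsub ha).le⟩

/-- With `κ₁ ≤ κ₀` proved, Proposition 3.8's pair condition for `m₁ + m₃ = −2(η₁ + η₀)` holds for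
every `Im ω ≥ 0` on every subextremal Kerr–de Sitter with `a ≠ 0` (`pairCondition_eventCauchy` made
unconditional). [cite: CasalsTeixeiradacosta2022, Proposition 3.8 (arXiv v2) with Lemma 3.5 and proof of Corollary 3.9] -/
theorem pairCondition_eventCauchy' {M a Λ : ℝ} (hsub : IsSubextremal M a Λ) (ha : a ≠ 0) {ω : ℂ}
    (hω : 0 ≤ ω.im) (m : ℝ) :
    PairCondition (-2 * (etaEvent M a Λ ω m + etaCauchy M a Λ ω m)) :=
  pairCondition_eventCauchy (surfaceGravity_rPlus_pos hsub) (surfaceGravity_rPlus_lt_rMinus hsub ha).le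
    hω

/-! ### Consequences of the Vieta relations: `|a| < L` and `Ξ < 2` follow from subextremality -/

/-- **Subextremality forces `a² < 3/Λ = L²`** (CTdC's standing hypothesis "Fix `M > 0`, `L > 0` and
`|a| < L` satisfying (3.1)" — the last clause already implies `|a| < L`): by `vieta_sq`,
`1 − Λa²/3 = (Λ/3)(s² − e₂)` with `s² − e₂ = r₋² + r₊² + r_c² + r₋r₊ + r₊r_c + r_cr₋ > 0`. In
particular the binder `a² < 3/Λ` of the named facts H1/H3 and of the venture's (H4) is automatic.
[cite: CasalsTeixeiradacosta2022, §3.1 (3.1)–(3.2)] -/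
theorem sq_lt_three_div_of_isSubextremal {M a Λ : ℝ} (hsub : IsSubextremal M a Λ) :
    a ^ 2 < 3 / Λ := by
  have hv := vieta_sq hsub
  have h0 := rMinus_nonneg M a Λ
  obtain ⟨hM, hΛ, h01, h12, -⟩ := hsub
  have hr₁ : 0 < rPlus M a Λ := lt_of_le_of_lt h0 h01
  have hpos : 0 < (rMinus M a Λ + rPlus M a Λ + rCosmo M a Λ) ^ 2 -
      (rMinus M a Λ * rPlus M a Λ + rPlus M a Λ * rCosmo M a Λ + rCosmo M a Λ * rMinus M a Λ) := by
    nlinarith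
  have h1 : 0 < 1 - Λ / 3 * a ^ 2 := by
    rw [hv]
    positivity
  rw [lt_div_iff₀ hΛ]
  nlinarith

/-- Equivalently `Λa² < 3`, i.e. `α = Λa²/3 < 1` and `Ξ = 1 + α < 2`, on every subextremal
Kerr–de Sitter. [cite: CasalsTeixeiradacosta2022, §3.1 (3.1)–(3.2)] -/
theorem xi_lt_two_of_isSubextremal {M a Λ : ℝ} (hsub : IsSubextremal M a Λ) : xi a Λ < 2 := by
  have h := sq_lt_three_div_of_isSubextremal hsub
  have hΛ : 0 < Λ := hsub.2.1
  unfold xi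
  rw [lt_div_iff₀ hΛ] at h
  nlinarith

/-- `|a| < √(3/Λ) = L` on every subextremal Kerr–de Sitter (the printed standing hypothesis
`|a| < L`). [cite: CasalsTeixeiradacosta2022, §3.1] -/
theorem abs_lt_deSitterRadius_of_isSubextremal {M a Λ : ℝ} (hsub : IsSubextremal M a Λ) :
    |a| < Real.sqrt (3 / Λ) := by
  have h := sq_lt_three_div_of_isSubextremal hsub
  rw [← Real.sqrt_sq (abs_nonneg a), sq_abs]
  exact Real.sqrt_lt_sqrt (sq_nonneg a) h

end Literature.Geometry.Lorentzian.KerrDeSitter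

end
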